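import Summits.AtomisticToContinuum.FouriersLaw.Theses.EmbeddedDrudeMourre
import HarnessLib

/-!
# `EmbeddedDrudeMourre.EngineGlue` — the engine glue, proved

Item `stmt-AtomisticToContinuum-12600` (support, route `EmbeddedDrudeMourre`, sub-problem `FouriersLaw`).
Statement: `FGRGap → MourreDissolution → DrudeDissolution`, where

* `FGRGap` says that for all `ω₂, a, b > 0` the linearised phonon Boltzmann form of the pinned chain has
  an odd-sector gap (`HasOddSectorGap ω₂ a b`);
* `MourreDissolution` is the conditional engine: for the pinned chain with parameters
  `ω₂, lam, β, γ > 0`, IF `HasOddSectorGap ω₂ lam β` THEN the dissolved-Drude-atom conclusion holds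
  below some `T₀ > 0`;
* `DrudeDissolution` is that same conclusion, unconditionally in the gap hypothesis.

Proof (folklore): modus ponens at each parameter point — the gap hypothesis of `MourreDissolution` at
`(ω₂, lam, β)` is supplied by `FGRGap` at `(ω₂, lam, β)`; the conclusions of `MourreDissolution` and
`DrudeDissolution` are syntactically identical. No analysis is involved; this file only makes the two
engine cruxes formally upstream of the target `DrudeDissolution` consumed by the route's `closes`.
The closing theorem is `engineGlue_proof`.
-/

namespace Summit.AtomisticToContinuum.FouriersLaw.Theorems.EmbeddedDrudeMourre

open Summit.AtomisticToContinuum.FouriersLaw.Theses.EmbeddedDrudeMourre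

/-- **Engine glue** (item `stmt-AtomisticToContinuum-12600`, folklore): `FGRGap → MourreDissolution →
DrudeDissolution` — at each parameter point `(ω₂, lam, β, γ)` with all four positive, feed the
odd-sector gap `FGRGap ω₂ lam β _ _ _ : HasOddSectorGap ω₂ lam β` into the conditional engine
`MourreDissolution`; its conclusion is literally that of `DrudeDissolution`. -/
theorem engineGlue_proof :
    Summit.AtomisticToContinuum.FouriersLaw.Theses.EmbeddedDrudeMourre.EngineGlue := by
  unfold Summit.AtomisticToContinuum.FouriersLaw.Theses.EmbeddedDrudeMourre.EngineGlue
  intro hF hM ω₂ lam β γ hω hl hβ hγ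
  exact hM ω₂ lam β γ hω hl hβ hγ (hF ω₂ lam β hω hl hβ)

end Summit.AtomisticToContinuum.FouriersLaw.Theorems.EmbeddedDrudeMourre
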